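import Literature.Geometry.Lorentzian.CoordBochner
import Literature.Geometry.Lorentzian.CoordCurvatureRicciIdentity
import Literature.Geometry.Lorentzian.CoordEntropyFormula
import Literature.Geometry.Lorentzian.CoordHarmonicCurvature
import HarnessLib

/-!
# The conformal Schouten field `W = Hess f + df ⊗ df − ½|∇f|² g + B` in coordinates:
# its covariant derivative and its rough Laplacian

A further layer of the coordinate tensor calculus (`CoordCurvature`, `CoordBianchi`,
`CoordBochner`, `CoordCurvatureRicciIdentity`, `CoordHarmonicCurvature`): metric components
`G : E → (E →L E →L ℝ)` smooth, symmetric and nondegenerate on an open set `V` (`IsMetricOn G V`),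
Christoffel map `Γ = chrAt G`, Hessian `Hess f = hessAt G f`, Laplacian `Δf = lapAt G f`,
gradient square `|∇f|² = gradSqAt G f`, covariant derivatives `cov₂At` / `cov₃At` of fields of
bilinear / trilinear forms along constant fields.

Support file for the named fact
`Literature.Geometry.Riemannian.gurskyViaclovsky_hessianEstimate_weighted_four`
(Gursky–Viaclovsky 2003, Prop. 6; Chen 2005, Thm. 1 (a)). Under `g_u = e^{−2u} g` the Schouten
tensor is `A_{g_u} = ∇²u + du ⊗ du − ½|∇u|² g + A_g` (Chen 2005, §2.1; Gursky–Viaclovsky 2003,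
§2, `A^1_u`), and the proof of the `C²` estimate (Chen 2005, §3) differentiates the tensor
`W = ∇²u + a du⊗du + b|∇u|²g + B` twice: "`W_{ij,k} = u_{ijk} + a_k u_iu_j + au_{ik}u_j + au_{jk}u_i
+ b_k|∇u|²δ_{ij} + 2bu_lu_{lk}δ_{ij} + B_{ij,k}`" and "`W_{ij,kk} = u_{ijkk} + … + a(u_{ikk}u_j
+ 2u_{ik}u_{jk} + u_iu_{jkk}) + (… + 2b|∇²u|² + 2bu_lu_{lkk})δ_{ij} + B_{ij,kk}`". This file proves
those formulas for constant `a = 1`, `b = −½` and a smooth field `B`, for a `C^∞` function `f`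
on `V` (the field `df ⊗ df` is written `smulRightL ℝ E _ (Df) (Df)`, the field `|∇f|² g` is
`gradSqAt G f • G`):

* `cov₂At_add`, `cov₂At_sub`, `cov₂At_smul` — linearity and the Leibniz rule `∇_X(φβ) = (∂_Xφ)β + φ∇_Xβ`;
* `IsMetricOn.cov₂At_smulRightL_fderiv`, `IsMetricOn.cov₃At_cov₂At_smulRightL_fderiv` —
  `∇_X(df⊗df)(Y,Z) = Hess f(X,Y)df(Z) + df(Y)Hess f(X,Z)` and
  `∇²_{X,A}(df⊗df)(B,C) = (∇_X Hess f)(A,B)df(C) + Hess f(A,B)Hess f(X,C) + Hess f(X,B)Hess f(A,C)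
   + df(B)(∇_X Hess f)(A,C)`;
* `IsMetricOn.cov₂At_gradSqAt_smul`, `IsMetricOn.cov₃At_cov₂At_gradSqAt_smul` —
  `∇_X(|∇f|²g) = 2Hess f(X,♯df) g` and `∇²_{X,A}(|∇f|²g) = Hess|∇f|²(X,A) g` (`∇g = 0`,
  `IsMetricOn.cov₂At_self`; `∂|∇f|² = 2Hess f(·,♯df)`, `IsMetricOn.fderiv_gradSqAt`);
* `IsMetricOn.cov₂At_schouten`, `IsMetricOn.cov₃At_cov₂At_schouten` — **`∇W` and `∇²W`** for
  `W = Hess f + df⊗df − ½|∇f|²g + B`;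
* `IsMetricOn.lap_schouten` — **the rough Laplacian `(ΔW)(B,C) = Σ g^{kl}(∇²_{b_k,b_l}W)(B,C)`**:
  `ΔW = Δ Hess f + (Δdf)⊗df + df⊗(Δdf) + 2 Hess f ∘_g Hess f − ½ Δ|∇f|² g + ΔB` with
  `(Δdf)(Z) = ∂_ZΔf + Ric(♯df,Z)` (the divergence of the Hessian, `IsMetricOn.sum_ginv_cov₂At_hessAt`)
  — Chen's `W_{ij,kk}` traced, the terms `2u_{ik}u_{jk}` and `2b|∇²u|²δ_{ij}` (inside `Δ|∇f|²`,
  Bochner, `IsMetricOn.lapAt_gradSqAt`) being the ones that survive in the maximum principle.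

Everything is by the Fréchet calculus on constant fields of the earlier layers; everything is
proved, and no definition and no statement of `Prop` type is introduced.

## References

* S. Chen, *Local estimates for some fully nonlinear elliptic equations*, IMRN 2005:63,
  3403–3425, §2.1 (`A_{g_u}`) and §3 (formulas for `W_{ij,k}`, `W_{ij,kk}`). [Chen2005]
* M. J. Gursky, J. A. Viaclovsky, J. Differential Geom. 63 (2003), §2 (`A^t_u`), Prop. 6.
  [GurskyViaclovsky2003]
* B. O'Neill, *Semi-Riemannian geometry with applications to relativity*, Academic Press 1983,
  Ch. 2, Prop. 2.13; Ch. 3, Prop. 3.13, Def. 3.48. [ONeill1983]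
-/

noncomputable section


set_option maxSynthPendingDepth 3

open Set Filter ContinuousLinearMap Module
open scoped Topology ContDiff

namespace Literature.Geometry.Lorentzian

namespace MetricCoord

variable {E : Type*} [NormedAddCommGroup E] [NormedSpace ℝ E] [CompleteSpace E]
  {G : E → E →L[ℝ] E →L[ℝ] ℝ} {V : Set E} {x : E} {f : E → ℝ}

/-! ### Linearity of `cov₂At` in the field -/

omit [CompleteSpace E] in
/-- `∇(β₁ + β₂) = ∇β₁ + ∇β₂`. [folklore] -/
theorem cov₂At_add {β₁ β₂ : E → E →L[ℝ] E →L[ℝ] ℝ} (h₁ : DifferentiableAt ℝ β₁ x)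
    (h₂ : DifferentiableAt ℝ β₂ x) :
    cov₂At G (fun y ↦ β₁ y + β₂ y) x = cov₂At G β₁ x + cov₂At G β₂ x := by
  ext W Y Z
  simp only [cov₂At_apply, fderiv_fun_add h₁ h₂, _root_.add_apply]
  ring

omit [CompleteSpace E] in
/-- `∇(β₁ − β₂) = ∇β₁ − ∇β₂`. [folklore] -/
theorem cov₂At_sub {β₁ β₂ : E → E →L[ℝ] E →L[ℝ] ℝ} (h₁ : DifferentiableAt ℝ β₁ x)
    (h₂ : DifferentiableAt ℝ β₂ x) :
    cov₂At G (fun y ↦ β₁ y - β₂ y) x = cov₂At G β₁ x - cov₂At G β₂ x := by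
  ext W Y Z
  simp only [cov₂At_apply, fderiv_fun_sub h₁ h₂, _root_.sub_apply]
  ring

/-! ### The field `df ⊗ df` -/

omit [CompleteSpace E] in
/-- `(df ⊗ df)(Y, Z) = df(Y) df(Z)`. [folklore] -/
theorem smulRightL_fderiv_apply (y Y Z : E) :
    ContinuousLinearMap.smulRightL ℝ E (E →L[ℝ] ℝ) (fderiv ℝ f y) (fderiv ℝ f y) Y Z =
      fderiv ℝ f y Y * fderiv ℝ f y Z := by
  simp [smul_eq_mul]

omit [CompleteSpace E] in
/-- The field `df ⊗ df` is `C^∞` on `V` for `f ∈ C^∞(V)`. [folklore] -/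
theorem contDiffOn_smulRightL_fderiv (hV : IsOpen V) (hf : ContDiffOn ℝ ∞ f V) :
    ContDiffOn ℝ ∞ (fun y ↦ ContinuousLinearMap.smulRightL ℝ E (E →L[ℝ] ℝ) (fderiv ℝ f y)
      (fderiv ℝ f y)) V := by
  have hD : ContDiffOn ℝ ∞ (fderiv ℝ f) V := hf.fderiv_of_isOpen hV (by simp)
  exact (ContinuousLinearMap.smulRightL ℝ E (E →L[ℝ] ℝ)).isBoundedBilinearMap.contDiff.comp_contDiffOn
    (hD.prodMk hD)

omit [CompleteSpace E] in
/-- The derivative of `df ⊗ df`: `∂_X (df(Y)df(Z)) = D²f(X,Y)df(Z) + df(Y)D²f(X,Z)`. [folklore] -/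
theorem fderiv_smulRightL_fderiv_apply (hV : IsOpen V) (hx : x ∈ V) (hf : ContDiffOn ℝ ∞ f V)
    (X Y Z : E) :
    fderiv ℝ (fun y ↦ ContinuousLinearMap.smulRightL ℝ E (E →L[ℝ] ℝ) (fderiv ℝ f y)
      (fderiv ℝ f y)) x X Y Z =
      fderiv ℝ (fderiv ℝ f) x X Y * fderiv ℝ f x Z + fderiv ℝ f x Y * fderiv ℝ (fderiv ℝ f) x X Z := by
  have hDf : DifferentiableAt ℝ (fderiv ℝ f) x :=
    (contDiffAt_fderiv_of_contDiffOn hV hf hx).differentiableAt (by simp)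
  rw [(ContinuousLinearMap.smulRightL ℝ E (E →L[ℝ] ℝ)).fderiv_of_bilinear hDf hDf]
  simp [smul_eq_mul]
  ring

omit [CompleteSpace E] in
/-- **`∇_X (df ⊗ df)(Y,Z) = Hess f(X,Y) df(Z) + df(Y) Hess f(X,Z)`** (`∇ df = Hess f`).
[cite: ONeill1983, Ch. 3, Def. 3.48] -/
theorem IsMetricOn.cov₂At_smulRightL_fderiv (hG : IsMetricOn G V) (hx : x ∈ V)
    (hf : ContDiffOn ℝ ∞ f V) (X Y Z : E) :
    cov₂At G (fun y ↦ ContinuousLinearMap.smulRightL ℝ E (E →L[ℝ] ℝ) (fderiv ℝ f y)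
      (fderiv ℝ f y)) x X Y Z =
      hessAt G f x X Y * fderiv ℝ f x Z + fderiv ℝ f x Y * hessAt G f x X Z := by
  rw [cov₂At_apply, fderiv_smulRightL_fderiv_apply hG.isOpen hx hf, smulRightL_fderiv_apply,
    smulRightL_fderiv_apply, hessAt_apply, hessAt_apply]
  ring

/-- **`∇²_{X,A} (df ⊗ df)(B,C) = (∇_X Hess f)(A,B) df(C) + Hess f(A,B) Hess f(X,C)
 + Hess f(X,B) Hess f(A,C) + df(B)(∇_X Hess f)(A,C)`** (Leibniz twice). [cite: ONeill1983, Ch. 2, Prop. 2.13] -/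
theorem IsMetricOn.cov₃At_cov₂At_smulRightL_fderiv (hG : IsMetricOn G V) (hx : x ∈ V)
    (hf : ContDiffOn ℝ ∞ f V) (X A B C : E) :
    cov₃At G (cov₂At G (fun y ↦ ContinuousLinearMap.smulRightL ℝ E (E →L[ℝ] ℝ) (fderiv ℝ f y)
      (fderiv ℝ f y))) x X A B C =
      cov₂At G (hessAt G f) x X A B * fderiv ℝ f x C + hessAt G f x A B * hessAt G f x X C
        + hessAt G f x X B * hessAt G f x A C + fderiv ℝ f x B * cov₂At G (hessAt G f) x X A C := by
  set dd : E → E →L[ℝ] E →L[ℝ] ℝ := fun y ↦ ContinuousLinearMap.smulRightL ℝ E (E →L[ℝ] ℝ)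
    (fderiv ℝ f y) (fderiv ℝ f y) with hdd
  have hddC : ContDiffAt ℝ ∞ dd x :=
    (contDiffOn_smulRightL_fderiv hG.isOpen hf x hx).contDiffAt (hG.mem_nhds hx)
  have hcovd : DifferentiableAt ℝ (cov₂At G dd) x := hG.differentiableAt_cov₂At hx hddC
  have hfx : ContDiffAt ℝ ∞ f x := (hf x hx).contDiffAt (hG.mem_nhds hx)
  have hDf : DifferentiableAt ℝ (fderiv ℝ f) x :=
    (hfx.fderiv_right (m := ∞) (by simp)).differentiableAt (by simp)
  have hH := hG.differentiableAt_hessAt hx hf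
  -- evaluation commutes with differentiation
  have hev : fderiv ℝ (cov₂At G dd) x X A B C = fderiv ℝ (fun y ↦ cov₂At G dd y A B C) x X := by
    have e1 : DifferentiableAt ℝ (fun y ↦ cov₂At G dd y A) x := differentiableAt_clm_apply_const hcovd A
    have e2 : DifferentiableAt ℝ (fun y ↦ cov₂At G dd y A B) x := differentiableAt_clm_apply_const e1 B
    rw [fderiv_clm_apply_const e2 C X, fderiv_clm_apply_const e1 B X, fderiv_clm_apply_const hcovd A X]
  -- the formula for `∇ (df ⊗ df)` near `x`
  have hnear : (fun y ↦ cov₂At G dd y A B C) =ᶠ[𝓝 x]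
      fun y ↦ hessAt G f y A B * fderiv ℝ f y C + fderiv ℝ f y B * hessAt G f y A C := by
    filter_upwards [hG.mem_nhds hx] with y hy using hG.cov₂At_smulRightL_fderiv hy hf A B C
  -- derivatives of the four scalar factors
  have d1 : HasFDerivAt (fun y ↦ hessAt G f y A B) (((fderiv ℝ (hessAt G f) x).flip A).flip B) x :=
    hasFDerivAt_clm_apply_const (hasFDerivAt_clm_apply_const hH.hasFDerivAt A) B
  have d2 : HasFDerivAt (fun y ↦ hessAt G f y A C) (((fderiv ℝ (hessAt G f) x).flip A).flip C) x :=
    hasFDerivAt_clm_apply_const (hasFDerivAt_clm_apply_const hH.hasFDerivAt A) C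
  have d3 : HasFDerivAt (fun y ↦ fderiv ℝ f y C) ((fderiv ℝ (fderiv ℝ f) x).flip C) x :=
    hasFDerivAt_clm_apply_const hDf.hasFDerivAt C
  have d4 : HasFDerivAt (fun y ↦ fderiv ℝ f y B) ((fderiv ℝ (fderiv ℝ f) x).flip B) x :=
    hasFDerivAt_clm_apply_const hDf.hasFDerivAt B
  have hder := ((d1.fun_mul d3).fun_add (d4.fun_mul d2)).fderiv
  have hc : ∀ P Q R, cov₂At G dd x P Q R = hessAt G f x P Q * fderiv ℝ f x R
      + fderiv ℝ f x Q * hessAt G f x P R := fun P Q R ↦ hG.cov₂At_smulRightL_fderiv hx hf P Q R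
  rw [cov₃At_apply, hev, hnear.fderiv_eq, hder, hc, hc, hc]
  simp only [_root_.add_apply, _root_.smul_apply, flip_apply, smul_eq_mul, cov₂At_apply, hessAt_apply]
  ring

/-! ### The field `|∇f|² g` -/

omit [CompleteSpace E] in
/-- `∇_X (φ β) = (∂_X φ) β + φ ∇_X β` for a scalar function `φ` and a field of bilinear forms `β`.
[cite: ONeill1983, Ch. 2, Prop. 2.13] -/
theorem cov₂At_smul {φ : E → ℝ} {β : E → E →L[ℝ] E →L[ℝ] ℝ} (hφ : DifferentiableAt ℝ φ x)
    (hβ : DifferentiableAt ℝ β x) (X : E) :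
    cov₂At G (fun y ↦ φ y • β y) x X = fderiv ℝ φ x X • β x + φ x • cov₂At G β x X := by
  ext Y Z
  simp only [cov₂At_apply, fderiv_fun_smul hφ hβ, _root_.add_apply, _root_.smul_apply, smul_eq_mul,
    ContinuousLinearMap.smulRight_apply]
  ring

/-- **`∇_X (|∇f|² g) = 2 Hess f(X, ♯df) g`** (`∂_X|∇f|² = 2 Hess f(X,♯df)`, `∇g = 0`).
[cite: ONeill1983, Ch. 3, Prop. 3.13] -/
theorem IsMetricOn.cov₂At_gradSqAt_smul (hG : IsMetricOn G V) (hx : x ∈ V)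
    (hf : ContDiffOn ℝ ∞ f V) (X Y Z : E) :
    cov₂At G (fun y ↦ gradSqAt G f y • G y) x X Y Z =
      2 * hessAt G f x X (sharpAt G x (fderiv ℝ f x)) * G x Y Z := by
  rw [cov₂At_smul (hG.differentiableAt_gradSqAt hx hf) (hG.differentiableAt hx), hG.cov₂At_self hx,
    hG.fderiv_gradSqAt hx hf]
  simp

/-- **`∇²_{X,A} (|∇f|² g)(B,C) = Hess(|∇f|²)(X,A) g(B,C)`**, with
`Hess|∇f|²(X,A) = 2[(∇_X Hess f)(A,♯df) + Hess f(A, ♯Hess f(X,·))]` (`IsMetricOn.hessAt_gradSqAt`).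
[cite: ONeill1983, Ch. 3, Prop. 3.13] -/
theorem IsMetricOn.cov₃At_cov₂At_gradSqAt_smul (hG : IsMetricOn G V) (hx : x ∈ V)
    (hf : ContDiffOn ℝ ∞ f V) (X A B C : E) :
    cov₃At G (cov₂At G (fun y ↦ gradSqAt G f y • G y)) x X A B C =
      hessAt G (gradSqAt G f) x X A * G x B C := by
  set gG : E → E →L[ℝ] E →L[ℝ] ℝ := fun y ↦ gradSqAt G f y • G y with hgG
  have hφ : ContDiffOn ℝ ∞ (gradSqAt G f) V := hG.contDiffOn_gradSqAt hf
  have hgGC : ContDiffAt ℝ ∞ gG x :=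
    ((hφ.smul hG.contDiffOn) x hx).contDiffAt (hG.mem_nhds hx)
  have hcovd : DifferentiableAt ℝ (cov₂At G gG) x := hG.differentiableAt_cov₂At hx hgGC
  have hφx : ContDiffAt ℝ ∞ (gradSqAt G f) x := (hφ x hx).contDiffAt (hG.mem_nhds hx)
  have hDφ : DifferentiableAt ℝ (fderiv ℝ (gradSqAt G f)) x :=
    (hφx.fderiv_right (m := ∞) (by simp)).differentiableAt (by simp)
  -- evaluation commutes with differentiation
  have hev : fderiv ℝ (cov₂At G gG) x X A B C = fderiv ℝ (fun y ↦ cov₂At G gG y A B C) x X := by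
    have e1 : DifferentiableAt ℝ (fun y ↦ cov₂At G gG y A) x := differentiableAt_clm_apply_const hcovd A
    have e2 : DifferentiableAt ℝ (fun y ↦ cov₂At G gG y A B) x := differentiableAt_clm_apply_const e1 B
    rw [fderiv_clm_apply_const e2 C X, fderiv_clm_apply_const e1 B X, fderiv_clm_apply_const hcovd A X]
  -- near `x`, `∇_A (|∇f|² g)(B,C) = ∂_A|∇f|² · g(B,C)`
  have hnear : (fun y ↦ cov₂At G gG y A B C) =ᶠ[𝓝 x]
      fun y ↦ fderiv ℝ (gradSqAt G f) y A * G y B C := by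
    filter_upwards [hG.mem_nhds hx] with y hy
    rw [hgG, cov₂At_smul (hG.differentiableAt_gradSqAt hy hf) (hG.differentiableAt hy), hG.cov₂At_self hy]
    simp
  have d1 : HasFDerivAt (fun y ↦ fderiv ℝ (gradSqAt G f) y A) ((fderiv ℝ (fderiv ℝ (gradSqAt G f)) x).flip A) x :=
    hasFDerivAt_clm_apply_const hDφ.hasFDerivAt A
  have d2 : HasFDerivAt (fun y ↦ G y B C) (((fderiv ℝ G x).flip B).flip C) x :=
    hasFDerivAt_clm_apply_const (hasFDerivAt_clm_apply_const (hG.differentiableAt hx).hasFDerivAt B) C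
  have hder := (d1.fun_mul d2).fderiv
  have hnearX : cov₂At G gG x (chrAt G x X A) B C = fderiv ℝ (gradSqAt G f) x (chrAt G x X A) * G x B C := by
    rw [hgG, cov₂At_smul (hG.differentiableAt_gradSqAt hx hf) (hG.differentiableAt hx), hG.cov₂At_self hx]
    simp
  have hnearB : ∀ Y Z, cov₂At G gG x A Y Z = fderiv ℝ (gradSqAt G f) x A * G x Y Z := by
    intro Y Z
    rw [hgG, cov₂At_smul (hG.differentiableAt_gradSqAt hx hf) (hG.differentiableAt hx), hG.cov₂At_self hx]
    simp
  rw [cov₃At_apply, hev, hnear.fderiv_eq, hder, hnearX, hnearB, hnearB, hessAt_apply]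
  simp only [_root_.add_apply, _root_.smul_apply, flip_apply, smul_eq_mul]
  rw [hG.fderiv_eq_chrAt hx X B C]
  ring

/-! ### The conformal Schouten field `W = Hess f + df ⊗ df − ½|∇f|² g + B` -/

section Schouten

variable {Bf : E → E →L[ℝ] E →L[ℝ] ℝ}

/-- **`∇W` for `W = Hess f + df⊗df − ½|∇f|²g + B`**:
`(∇_X W)(Y,Z) = (∇_X Hess f)(Y,Z) + Hess f(X,Y)df(Z) + df(Y)Hess f(X,Z) − Hess f(X,♯df) g(Y,Z) + (∇_X B)(Y,Z)`.
[cite: Chen2005, §3, formula for W_{ij,k}] -/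
theorem IsMetricOn.cov₂At_schouten (hG : IsMetricOn G V) (hx : x ∈ V) (hf : ContDiffOn ℝ ∞ f V)
    (hB : ContDiffOn ℝ ∞ Bf V) (X Y Z : E) :
    cov₂At G (fun y ↦ hessAt G f y
        + ContinuousLinearMap.smulRightL ℝ E (E →L[ℝ] ℝ) (fderiv ℝ f y) (fderiv ℝ f y)
        - (1 / 2 : ℝ) • (gradSqAt G f y • G y) + Bf y) x X Y Z =
      cov₂At G (hessAt G f) x X Y Z + hessAt G f x X Y * fderiv ℝ f x Z
        + fderiv ℝ f x Y * hessAt G f x X Z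
        - hessAt G f x X (sharpAt G x (fderiv ℝ f x)) * G x Y Z + cov₂At G Bf x X Y Z := by
  have hH := hG.differentiableAt_hessAt hx hf
  have hdd : DifferentiableAt ℝ (fun y ↦ ContinuousLinearMap.smulRightL ℝ E (E →L[ℝ] ℝ)
      (fderiv ℝ f y) (fderiv ℝ f y)) x :=
    ((contDiffOn_smulRightL_fderiv hG.isOpen hf x hx).contDiffAt (hG.mem_nhds hx)).differentiableAt
      (by simp)
  have hgG : DifferentiableAt ℝ (fun y ↦ gradSqAt G f y • G y) x :=
    (hG.differentiableAt_gradSqAt hx hf).smul (hG.differentiableAt hx)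
  have hgG2 : DifferentiableAt ℝ (fun y ↦ (1 / 2 : ℝ) • (gradSqAt G f y • G y)) x := hgG.fun_const_smul _
  have hBx : DifferentiableAt ℝ Bf x := ((hB x hx).contDiffAt (hG.mem_nhds hx)).differentiableAt (by simp)
  have e1 : DifferentiableAt ℝ (fun y ↦ hessAt G f y
      + ContinuousLinearMap.smulRightL ℝ E (E →L[ℝ] ℝ) (fderiv ℝ f y) (fderiv ℝ f y)) x := hH.add hdd
  have e2 : DifferentiableAt ℝ (fun y ↦ hessAt G f y
      + ContinuousLinearMap.smulRightL ℝ E (E →L[ℝ] ℝ) (fderiv ℝ f y) (fderiv ℝ f y)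
      - (1 / 2 : ℝ) • (gradSqAt G f y • G y)) x := e1.sub hgG2
  rw [cov₂At_add e2 hBx, cov₂At_sub e1 hgG2, cov₂At_add hH hdd, cov₂At_const_smul hgG]
  simp only [_root_.add_apply, _root_.sub_apply, _root_.smul_apply, smul_eq_mul,
    hG.cov₂At_smulRightL_fderiv hx hf, hG.cov₂At_gradSqAt_smul hx hf]
  ring

/-- **`∇²W`**: `(∇²_{X,A} W)(B,C) = (∇²_{X,A} Hess f)(B,C) + [(∇_X Hess f)(A,B)df(C) + Hess f(A,B)Hess f(X,C)
 + Hess f(X,B)Hess f(A,C) + df(B)(∇_X Hess f)(A,C)] − ½ Hess|∇f|²(X,A) g(B,C) + (∇²_{X,A} B)(B,C)`.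
[cite: Chen2005, §3, formula for W_{ij,kk}] -/
theorem IsMetricOn.cov₃At_cov₂At_schouten (hG : IsMetricOn G V) (hx : x ∈ V)
    (hf : ContDiffOn ℝ ∞ f V) (hB : ContDiffOn ℝ ∞ Bf V) (X A B C : E) :
    cov₃At G (cov₂At G (fun y ↦ hessAt G f y
        + ContinuousLinearMap.smulRightL ℝ E (E →L[ℝ] ℝ) (fderiv ℝ f y) (fderiv ℝ f y)
        - (1 / 2 : ℝ) • (gradSqAt G f y • G y) + Bf y)) x X A B C =
      cov₃At G (cov₂At G (hessAt G f)) x X A B C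
        + (cov₂At G (hessAt G f) x X A B * fderiv ℝ f x C + hessAt G f x A B * hessAt G f x X C
          + hessAt G f x X B * hessAt G f x A C + fderiv ℝ f x B * cov₂At G (hessAt G f) x X A C)
        - 1 / 2 * (hessAt G (gradSqAt G f) x X A * G x B C)
        + cov₃At G (cov₂At G Bf) x X A B C := by
  set dd : E → E →L[ℝ] E →L[ℝ] ℝ := fun y ↦ ContinuousLinearMap.smulRightL ℝ E (E →L[ℝ] ℝ)
    (fderiv ℝ f y) (fderiv ℝ f y) with hdd
  set gG : E → E →L[ℝ] E →L[ℝ] ℝ := fun y ↦ gradSqAt G f y • G y with hgG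
  -- smoothness of the four fields on `V`
  have cH : ContDiffOn ℝ ∞ (hessAt G f) V := hG.contDiffOn_hessAt hf
  have cdd : ContDiffOn ℝ ∞ dd V := contDiffOn_smulRightL_fderiv hG.isOpen hf
  have cgG : ContDiffOn ℝ ∞ gG V := (hG.contDiffOn_gradSqAt hf).smul hG.contDiffOn
  have cgG2 : ContDiffOn ℝ ∞ (fun y ↦ (1 / 2 : ℝ) • gG y) V := fun y hy ↦ (cgG y hy).const_smul _
  have cat : ∀ {β : E → E →L[ℝ] E →L[ℝ] ℝ}, ContDiffOn ℝ ∞ β V → ∀ {y}, y ∈ V → ContDiffAt ℝ ∞ β y :=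
    fun hβ y hy ↦ (hβ y hy).contDiffAt (hG.mem_nhds hy)
  have dat : ∀ {β : E → E →L[ℝ] E →L[ℝ] ℝ}, ContDiffOn ℝ ∞ β V → ∀ {y}, y ∈ V → DifferentiableAt ℝ β y :=
    fun hβ y hy ↦ (cat hβ hy).differentiableAt (by simp)
  -- `∇W` as a sum of fields near `x`
  have hnear : cov₂At G (fun y ↦ hessAt G f y + dd y - (1 / 2 : ℝ) • gG y + Bf y) =ᶠ[𝓝 x]
      fun y ↦ cov₂At G (hessAt G f) y + cov₂At G dd y - (1 / 2 : ℝ) • cov₂At G gG y + cov₂At G Bf y := by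
    filter_upwards [hG.mem_nhds hx] with y hy
    have e1 : DifferentiableAt ℝ (fun z ↦ hessAt G f z + dd z) y := (dat cH hy).add (dat cdd hy)
    have e2 : DifferentiableAt ℝ (fun z ↦ hessAt G f z + dd z - (1 / 2 : ℝ) • gG z) y :=
      e1.sub (dat cgG2 hy)
    rw [cov₂At_add e2 (dat hB hy), cov₂At_sub e1 (dat cgG2 hy), cov₂At_add (dat cH hy) (dat cdd hy),
      cov₂At_const_smul (dat cgG hy)]
  -- differentiability of the four covariant derivatives at `x`
  have d1 := hG.differentiableAt_cov₂At hx (cat cH hx)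
  have d2 := hG.differentiableAt_cov₂At hx (cat cdd hx)
  have d3 := hG.differentiableAt_cov₂At hx (cat cgG hx)
  have d3' : DifferentiableAt ℝ (fun y ↦ (1 / 2 : ℝ) • cov₂At G gG y) x := d3.fun_const_smul _
  have d4 := hG.differentiableAt_cov₂At hx (cat hB hx)
  have e1 : DifferentiableAt ℝ (fun y ↦ cov₂At G (hessAt G f) y + cov₂At G dd y) x := d1.add d2
  have e2 : DifferentiableAt ℝ (fun y ↦ cov₂At G (hessAt G f) y + cov₂At G dd y
      - (1 / 2 : ℝ) • cov₂At G gG y) x := e1.sub d3'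
  rw [cov₃At_congr hnear, cov₃At_add e2 d4, cov₃At_sub e1 d3', cov₃At_add d1 d2, cov₃At_const_smul d3]
  simp only [_root_.add_apply, _root_.sub_apply, _root_.smul_apply, smul_eq_mul]
  rw [hG.cov₃At_cov₂At_smulRightL_fderiv hx hf, hG.cov₃At_cov₂At_gradSqAt_smul hx hf]

variable {ι : Type*} [Fintype ι] [FiniteDimensional ℝ E] (b : Basis ι ℝ E)

/-- **The rough Laplacian of `W = Hess f + df⊗df − ½|∇f|²g + B`** (Chen 2005, §3, the trace of
`W_{ij,kk}`): with `(ΔT)(B,C) = Σ g^{kl}(∇²_{b_k,b_l}T)(B,C)` and `(Δ df)(Z) = ∂_Z Δf + Ric(♯df, Z)`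
(`IsMetricOn.sum_ginv_cov₂At_hessAt`),
`(ΔW)(B,C) = (Δ Hess f)(B,C) + (Δdf)(B)df(C) + df(B)(Δdf)(C)
 + Σ g^{kl}[Hess f(b_l,B)Hess f(b_k,C) + Hess f(b_k,B)Hess f(b_l,C)] − ½ Δ|∇f|² g(B,C) + (ΔB)(B,C)`.
[cite: Chen2005, §3] -/
theorem IsMetricOn.lap_schouten (hG : IsMetricOn G V) (hx : x ∈ V) (hf : ContDiffOn ℝ ∞ f V)
    (hB : ContDiffOn ℝ ∞ Bf V) (B C : E) :
    ∑ k, ∑ l, ginv G b x k l * cov₃At G (cov₂At G (fun y ↦ hessAt G f y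
        + ContinuousLinearMap.smulRightL ℝ E (E →L[ℝ] ℝ) (fderiv ℝ f y) (fderiv ℝ f y)
        - (1 / 2 : ℝ) • (gradSqAt G f y • G y) + Bf y)) x (b k) (b l) B C =
      ∑ k, ∑ l, ginv G b x k l * cov₃At G (cov₂At G (hessAt G f)) x (b k) (b l) B C
      + ((fderiv ℝ (lapAt G f) x B + ricAt G x (sharpAt G x (fderiv ℝ f x)) B) * fderiv ℝ f x C
        + fderiv ℝ f x B * (fderiv ℝ (lapAt G f) x C + ricAt G x (sharpAt G x (fderiv ℝ f x)) C))
      + ∑ k, ∑ l, ginv G b x k l *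
          (hessAt G f x (b l) B * hessAt G f x (b k) C + hessAt G f x (b k) B * hessAt G f x (b l) C)
      - 1 / 2 * (lapAt G (gradSqAt G f) x * G x B C)
      + ∑ k, ∑ l, ginv G b x k l * cov₃At G (cov₂At G Bf) x (b k) (b l) B C := by
  have h1 : ∑ k, ∑ l, ginv G b x k l * (cov₂At G (hessAt G f) x (b k) (b l) B * fderiv ℝ f x C) =
      (fderiv ℝ (lapAt G f) x B + ricAt G x (sharpAt G x (fderiv ℝ f x)) B) * fderiv ℝ f x C := by
    rw [← hG.sum_ginv_cov₂At_hessAt b hx hf B, Finset.sum_mul]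
    refine Finset.sum_congr rfl fun k _ ↦ ?_
    rw [Finset.sum_mul]
    refine Finset.sum_congr rfl fun l _ ↦ ?_
    ring
  have h2 : ∑ k, ∑ l, ginv G b x k l * (fderiv ℝ f x B * cov₂At G (hessAt G f) x (b k) (b l) C) =
      fderiv ℝ f x B * (fderiv ℝ (lapAt G f) x C + ricAt G x (sharpAt G x (fderiv ℝ f x)) C) := by
    rw [← hG.sum_ginv_cov₂At_hessAt b hx hf C, Finset.mul_sum]
    refine Finset.sum_congr rfl fun k _ ↦ ?_
    rw [Finset.mul_sum]
    refine Finset.sum_congr rfl fun l _ ↦ ?_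
    ring
  have h3 : ∑ k, ∑ l, ginv G b x k l * (1 / 2 * (hessAt G (gradSqAt G f) x (b k) (b l) * G x B C)) =
      1 / 2 * (lapAt G (gradSqAt G f) x * G x B C) := by
    rw [lapAt_eq_sum G b, Finset.sum_mul, Finset.mul_sum]
    refine Finset.sum_congr rfl fun k _ ↦ ?_
    rw [Finset.sum_mul, Finset.mul_sum]
    refine Finset.sum_congr rfl fun l _ ↦ ?_
    rw [hessAt_apply]
    ring
  rw [← h1, ← h2, ← h3]
  simp only [← Finset.sum_add_distrib, ← Finset.sum_sub_distrib]
  refine Finset.sum_congr rfl fun k _ ↦ Finset.sum_congr rfl fun l _ ↦ ?_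
  rw [hG.cov₃At_cov₂At_schouten hx hf hB]
  ring

end Schouten

end MetricCoord

end Literature.Geometry.Lorentzian

end
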